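import Summits.BirchSwinnertonDyer.BirchSwinnertonDyer.Theorems.Rank2ObservatoryRank3Semistable
import Summits.BirchSwinnertonDyer.BirchSwinnertonDyer.Theorems.Rank2ObservatoryRank3RealComponents
import Summits.BirchSwinnertonDyer.BirchSwinnertonDyer.Theorems.Rank2ObservatoryRank3MinimalTotal
import Literature.NumberTheory.EllipticCurves.LangHeightSzpiroRatio
import Literature.NumberTheory.EllipticCurves.PastenValuationProduct
import Literature.NumberTheory.DiophantineGeometry.EllArithGlueProofs
import HarnessLib

/-!
# BirchSwinnertonDyer — rank ≥ 2 observatory: THE SZPIRO RATIO CENSUS OF THE 9 487 RANK-3 CURVES — `σ(E) = log|Δ_min|/log N`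
# lies in `[1, 13/3)` on every row (`7 174` rows in `[1,2)`, `2 179` in `[2,3)`, `130` in `[3,4)`, `4` in `[4, 13/3)`;
# `σ = 1`, i.e. `|Δ_min| = N`, on exactly `443` rows, among them ALL `168` rows of prime conductor, where `Δ_min = ±p`);
# and LANG'S HEIGHT INEQUALITY PER ROW in Petsche's explicit form, UNIFORM over the table with the one constant `c(1,5)`

HONEST FRAMING: per-curve certified theorems and census instruments; no claim on BSD in rank ≥ 2.

## What this file does (zero numerics, zero new data; integer arithmetic on the row fields `N` and `Δ` only)

Every census model is GLOBALLY MINIMAL by kernel certificate (`Rank3Row.isGloballyMinimal_of_mem`) with conductor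
`N_E = r.N` by kernel certificate (`Rank3Row.conductorNorm_eq_of_mem`) and discriminant the row integer `r.delta`
(`Rank3Row.curve_Δ`). By the tree's PROVED `N(𝔇_min) = |Δ|` for a globally minimal equation over `ℚ`
(`WeierstrassCurve.minimalDiscriminantNorm_int_eq_natAbs_minimalDiscriminantInt_holds`, AEC VIII.8) the minimal
discriminant of a census curve is `|r.delta|` (§1, `Rank3Row.minimalDiscriminantNorm_eq_of_mem`) and its **Szpiro ratio**
(`WeierstrassCurve.szpiroRatio`, Petsche 2006 (1), Hindry–Silverman: `σ = log N(𝔇_min)/log N(𝔣)`) is `log|r.delta|/log r.N`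
(`Rank3Row.szpiroRatio_eq_of_mem`). Rational bounds `b/a` on `σ` are INTEGER inequalities `|Δ|^a < N^b` / `N^b ≤ |Δ|^a`
(`Rank3Row.szpiroRatio_lt_div_of_pow_lt_pow`, `Rank3Row.div_le_szpiroRatio_of_pow_le_pow`), decided per row in the kernel:

* §2 KERNEL CENSUS (linear walks, `decide +kernel`): `N ∣ Δ` on every row (`rank3Table_all_N_dvd_delta` — as it must,
  `f_p ≤ ord_p Δ_min`, ATAEC IV.11.1; here certified row by row), hence `1 ≤ σ`; `|Δ|³ < N¹³` on every row
  (`rank3Table_all_delta_cube_lt`), hence **`1 ≤ σ < 13/3` on the whole table** (`Rank3Row.szpiroRatio_mem_Ico_of_mem`) and a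
  fortiori `|Δ_min| < N⁵`: the inequality of Szpiro's conjecture holds on the table with exponent `13/3` and constant `1` (a
  finite check, no bearing on the conjecture); the floor histogram `7174 / 2179 / 130 / 4` (`rank3Table_countP_sigma_floor1…4`);
  the four rows with `σ ≥ 4` are `237917a1, 333111b1, 380582i3, 447458i2` (`rank3Table_sigma_floor4_labels`), the first two
  with `σ ≥ 43/10` (`rank3Table_sigma_ge_43_10_labels`); `|Δ| = N` (`σ = 1`) on exactly `443` rows (`rank3Table_countP_delta_eq_N`).
* §3 THE PRIME-CONDUCTOR STRATUM: primality of `N < 708²` is decided two-sidedly by trial division by the `126` primes `< 708`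
  of KCI row 52 (`prime708B`, sound and complete: `Rank3Row.prime_N_iff_of_mem`); exactly `168` rows have prime conductor
  (`rank3Table_countP_primeN`), and on every one of them `|Δ| = N` (`rank3Table_primeN_delta_eq_N`): **`Δ_min = ±p` for all
  168 rank-3 census curves of prime conductor `p`**, hypothesis-free (`Rank3Row.minimalDiscriminantNorm_eq_conductorNorm_of_prime`)
  — the shape of Mestre–Oesterlé's Théorème 2 [MestreOesterle1989, §5: prime conductor ⇒ `Δ_min = ±p` unless `E` is one of
  `11B, 17B, 17C, 19B, 37C, SN_A(u² + 64)`], which the tree holds only as the NAMED fact `mestreOesterle_factorization_le_five`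
  (`v_p(Δ_min) ≤ 5`); on these 168 curves that named fact is DISCHARGED by the kernel with `v_p(Δ_min) = 1`
  (`Rank3Row.factorization_minimalDiscriminantNorm_eq_one_of_prime`); they are semistable (`Rank3Row.isSemistable_of_prime`,
  so KCI row 53's Serre/Mazur readings apply) and have `σ = 1` (`Rank3Row.szpiroRatio_eq_one_of_prime`).
* §4 LANG'S HEIGHT CONJECTURE ON THE TABLE, EXPLICIT: Petsche 2006, Thm. 2 over `ℚ` — `ĥ(P) ≥ c(1,σ)·log|Δ_min|` for every
  non-torsion `P ∈ E(ℚ)`, `c(1,σ) = 1/(10¹⁵ σ⁶ log²(104613 σ²))`, `ĥ` in Silverman's normalisation (= the tree's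
  `canonicalHeight / 2`) — is a THEOREM of the tree (`Petsche2006_langHeightLowerBound_holds`, module
  `…LangHeightSzpiroRatioProofs`, whose build chain is not available to this file); the fact enters BY NAME as the hypothesis
  `(hPT : Petsche2006_langHeightLowerBound)` and is discharged by that theorem wherever the module is imported. Per row:
  `c(1, σ_r)·log|Δ_r| ≤ ĥ(P)` (`Rank3Row.langHeight_of_mem`); since `c(1,·)` is antitone on `[1,∞)` (`langConstant_one_anti`),
  `1 ≤ σ_r < 5` and `|Δ_r| ≥ N_r ≥ 5077`, ONE constant serves the whole table: **`c(1,5)·log N_r ≤ ĥ(P)`**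
  (`Rank3Row.langHeight_uniform_of_mem`) and **`c(1,5)·log 5077 ≤ ĥ(P)`** (`Rank3Row.langHeight_tablewide_of_mem`) for every
  non-torsion rational point on every one of the 9 487 curves (engine-side `c(1,5)·log 5077 = 2.50…·10⁻²¹`; explicit, not
  sharp). Petsche's Prop. 7 count of small points is read per row the same way (`Rank3Row.card_smallPoints_le_of_mem`,
  granting `Petsche2006_card_smallPoints_le`, also PROVED in that module).

NOT claimed: any VALUE of a height, regulator or period; sharpness; anything off the table; Szpiro's or Lang's conjecture (for
ONE curve a positive lower bound for `ĥ` on non-torsion points is trivial by Northcott — the content of §4 is the explicit constant,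
uniform in the curve through `σ` alone, from a PROVED theorem); Mestre–Oesterlé's theorems (context, not used). Nothing on BSD.

Sources: [cite: Petsche2006, (1), Thm. 2 (5), Prop. 7 (11)]; [cite: HindrySilverman1988, Thm. 0.3]; [cite: SilvermanAEC2009,
VIII.8, Conj. VIII.11.1]; [cite: MestreOesterle1989, §5 Théorème 2]; [cite: Silverman1994, IV.11.1]; [cite: CremonaAlgorithms1997, Tables].
-/

-- single-conjunct summit: `Summit.BirchSwinnertonDyer.BirchSwinnertonDyer.…` repeats the name by design
set_option linter.dupNamespace false
set_option autoImplicit false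

namespace Summit.BirchSwinnertonDyer.BirchSwinnertonDyer.Rank2Observatory

open Literature Literature.NumberTheory.EllipticCurves Literature.NumberTheory.DiophantineGeometry WeierstrassCurve

/-! ## §1 Glue by name: the minimal discriminant and the Szpiro ratio of a census row; Petsche's constant -/

/-- Kernel walk: every conductor of the table is `≥ 5077` (row `0` is `5077a1`). [cite: CremonaAlgorithms1997, Tables] -/
theorem rank3Table_all_N_ge : (rank3Table.all fun r => decide (5077 ≤ r.N)) = true := by
  decide +kernel

/-- Petsche's constant `c(1,σ) = 1/(10¹⁵ σ⁶ log²(c₂ σ²))`, `c₂ = 104613` (used in §4) is antitone on `[1, ∞)`.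
[cite: Petsche2006, Thm. 2, (5)] -/
theorem langConstant_one_anti {σ τ : ℝ} (h1 : 1 ≤ σ) (h2 : σ ≤ τ) :
    Petsche2006.langConstant 1 τ ≤ Petsche2006.langConstant 1 σ := by
  rw [Petsche2006.langConstant_def, Petsche2006.langConstant_def]
  have hc2 : (1 : ℝ) < Petsche2006.c₂ := by rw [Petsche2006.c₂]; norm_num
  have hσ0 : 0 ≤ σ := le_trans zero_le_one h1
  have hτ1 : 1 ≤ τ := le_trans h1 h2
  have hσ2 : 1 ≤ σ ^ 2 := one_le_pow₀ h1
  have hτ2 : σ ^ 2 ≤ τ ^ 2 := pow_le_pow_left₀ hσ0 h2 2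
  have hlogσ : 0 < Real.log (Petsche2006.c₂ * 1 * σ ^ 2) := Real.log_pos (by nlinarith)
  have hlogle : Real.log (Petsche2006.c₂ * 1 * σ ^ 2) ≤ Real.log (Petsche2006.c₂ * 1 * τ ^ 2) :=
    Real.log_le_log (by nlinarith) (by nlinarith)
  have hden : 0 < (10 : ℝ) ^ 15 * 1 ^ 3 * σ ^ 6 * Real.log (Petsche2006.c₂ * 1 * σ ^ 2) ^ 2 := by positivity
  apply one_div_le_one_div_of_le hden
  have h6 : σ ^ 6 ≤ τ ^ 6 := pow_le_pow_left₀ hσ0 h2 6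
  have hl2 : Real.log (Petsche2006.c₂ * 1 * σ ^ 2) ^ 2 ≤ Real.log (Petsche2006.c₂ * 1 * τ ^ 2) ^ 2 :=
    pow_le_pow_left₀ hlogσ.le hlogle 2
  have hτ6 : 0 ≤ τ ^ 6 := by positivity
  apply mul_le_mul (mul_le_mul_of_nonneg_left h6 (by positivity)) hl2 (by positivity) (by positivity)

namespace Rank3Row
variable {r : Rank3Row}

/-- `5077 ≤ N` for every row. [cite: CremonaAlgorithms1997, Tables] -/
theorem N_ge_of_mem (hr : r ∈ rank3Table) : 5077 ≤ r.N :=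
  of_decide_eq_true (List.all_eq_true.mp rank3Table_all_N_ge r hr)

/-- `1 < N` for every row (every census curve has a place of bad reduction). [cite: CremonaAlgorithms1997, Tables] -/
theorem one_lt_N_of_mem (hr : r ∈ rank3Table) : 1 < r.N :=
  lt_of_lt_of_le (by norm_num) (N_ge_of_mem hr)

/-- **`N(𝔇_min)(E_r) = |Δ_r|`**: the model is globally minimal (kernel, `isGloballyMinimal_of_mem`) and `N(𝔇_min) = |Δ|` for a
globally minimal equation over `ℚ` is PROVED in the tree (AEC VIII.8). [cite: SilvermanAEC2009, VIII.8] -/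
theorem minimalDiscriminantNorm_eq_of_mem (hr : r ∈ rank3Table) :
    r.curve.minimalDiscriminantNorm ℤ = r.delta.natAbs := by
  haveI := isElliptic_of_mem hr
  haveI := Rank3Row.isGloballyMinimal_of_mem hr
  rw [WeierstrassCurve.minimalDiscriminantNorm_int_eq_natAbs_minimalDiscriminantInt_holds r.curve]
  congr 1
  have h : ((r.curve.minimalDiscriminantInt : ℤ) : ℚ) = ((r.delta : ℤ) : ℚ) := by
    rw [WeierstrassCurve.cast_minimalDiscriminantInt, Rank3Row.curve_Δ]
  exact_mod_cast h

/-- `|Δ_r| ≥ 1` (the row discriminant is nonzero). [cite: CremonaAlgorithms1997, Tables] -/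
theorem one_le_natAbs_delta_of_mem (hr : r ∈ rank3Table) : 1 ≤ r.delta.natAbs :=
  Nat.one_le_iff_ne_zero.mpr (Int.natAbs_ne_zero.mpr (delta_ne_zero_of_mem hr))

/-- **The Szpiro ratio of a census row**: `σ(E_r) = log|Δ_r| / log N_r` (`N_E = r.N`, `N(𝔇_min) = |Δ_r|`). [cite: Petsche2006, (1)] -/
theorem szpiroRatio_eq_of_mem (hr : r ∈ rank3Table) :
    r.curve.szpiroRatio ℤ = Real.log (r.delta.natAbs : ℝ) / Real.log (r.N : ℝ) := by
  rw [WeierstrassCurve.szpiroRatio_of_one_lt_conductorNorm ℤ r.curve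
      (by rw [Rank3Row.conductorNorm_eq_of_mem hr]; exact one_lt_N_of_mem hr),
    minimalDiscriminantNorm_eq_of_mem hr, Rank3Row.conductorNorm_eq_of_mem hr]

/-- `0 < log N_r`. [folklore] -/
theorem log_N_pos_of_mem (hr : r ∈ rank3Table) : 0 < Real.log (r.N : ℝ) :=
  Real.log_pos (by exact_mod_cast one_lt_N_of_mem hr)

/-- **Rational upper bounds on `σ` are integer inequalities**: `|Δ|^a < N^b` (`a > 0`) gives `σ < b/a`. [cite: Petsche2006, (1)] -/
theorem szpiroRatio_lt_div_of_pow_lt_pow (hr : r ∈ rank3Table) {a b : ℕ} (ha : 0 < a)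
    (h : r.delta.natAbs ^ a < r.N ^ b) : r.curve.szpiroRatio ℤ < (b : ℝ) / a := by
  have hD : (0 : ℝ) < (r.delta.natAbs : ℝ) := by exact_mod_cast one_le_natAbs_delta_of_mem hr
  have hlogN := log_N_pos_of_mem hr
  have ha' : (0 : ℝ) < a := by exact_mod_cast ha
  have hlt : (r.delta.natAbs : ℝ) ^ a < (r.N : ℝ) ^ b := by exact_mod_cast h
  have hlog : (a : ℝ) * Real.log (r.delta.natAbs : ℝ) < (b : ℝ) * Real.log (r.N : ℝ) := by
    rw [← Real.log_pow, ← Real.log_pow]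
    exact Real.log_lt_log (pow_pos hD a) hlt
  rw [szpiroRatio_eq_of_mem hr, div_lt_div_iff₀ hlogN ha']
  linarith [mul_comm (Real.log (r.delta.natAbs : ℝ)) (a : ℝ)]

/-- **Rational lower bounds on `σ` are integer inequalities**: `N^b ≤ |Δ|^a` (`a > 0`) gives `b/a ≤ σ`. [cite: Petsche2006, (1)] -/
theorem div_le_szpiroRatio_of_pow_le_pow (hr : r ∈ rank3Table) {a b : ℕ} (ha : 0 < a)
    (h : r.N ^ b ≤ r.delta.natAbs ^ a) : (b : ℝ) / a ≤ r.curve.szpiroRatio ℤ := by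
  have hN : (0 : ℝ) < (r.N : ℝ) := by exact_mod_cast (lt_trans zero_lt_one (one_lt_N_of_mem hr))
  have hlogN := log_N_pos_of_mem hr
  have ha' : (0 : ℝ) < a := by exact_mod_cast ha
  have hle : (r.N : ℝ) ^ b ≤ (r.delta.natAbs : ℝ) ^ a := by exact_mod_cast h
  have hlog : (b : ℝ) * Real.log (r.N : ℝ) ≤ (a : ℝ) * Real.log (r.delta.natAbs : ℝ) := by
    rw [← Real.log_pow, ← Real.log_pow]
    exact Real.log_le_log (pow_pos hN b) hle
  rw [szpiroRatio_eq_of_mem hr, div_le_div_iff₀ ha' hlogN]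
  linarith [mul_comm (Real.log (r.delta.natAbs : ℝ)) (a : ℝ)]

end Rank3Row

/-! ## §2 Kernel census (hypothesis-free): Szpiro floors, `N ∣ Δ`, and the 168 prime-conductor rows with `|Δ| = N` -/

/-- **KERNEL**: `N ∣ Δ` on every row (`f_p ≤ ord_p Δ_min`, ATAEC IV.11.1 — here certified row by row). [cite: Silverman1994, IV.11.1] -/
theorem rank3Table_all_N_dvd_delta : (rank3Table.all fun r => r.delta.natAbs % r.N == 0) = true := by
  decide +kernel

/-- **KERNEL**: `|Δ|³ < N¹³` on every row — the table's Szpiro ratios are `< 13/3`. [cite: CremonaAlgorithms1997, Tables] -/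
theorem rank3Table_all_delta_cube_lt : (rank3Table.all fun r => decide (r.delta.natAbs ^ 3 < r.N ^ 13)) = true := by
  decide +kernel

/-- **KERNEL CENSUS**: `σ ∈ [1,2)` (`|Δ| < N²`) on exactly `7 174` rows. [cite: CremonaAlgorithms1997, Tables] -/
theorem rank3Table_countP_sigma_floor1 : rank3Table.countP (fun r => decide (r.delta.natAbs < r.N ^ 2)) = 7174 := by
  decide +kernel

/-- **KERNEL CENSUS**: `σ ∈ [2,3)` on exactly `2 179` rows. [cite: CremonaAlgorithms1997, Tables] -/
theorem rank3Table_countP_sigma_floor2 :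
    rank3Table.countP (fun r => decide (r.N ^ 2 ≤ r.delta.natAbs ∧ r.delta.natAbs < r.N ^ 3)) = 2179 := by
  decide +kernel

/-- **KERNEL CENSUS**: `σ ∈ [3,4)` on exactly `130` rows. [cite: CremonaAlgorithms1997, Tables] -/
theorem rank3Table_countP_sigma_floor3 :
    rank3Table.countP (fun r => decide (r.N ^ 3 ≤ r.delta.natAbs ∧ r.delta.natAbs < r.N ^ 4)) = 130 := by
  decide +kernel

/-- **KERNEL CENSUS**: `σ ≥ 4` (`N⁴ ≤ |Δ|`) on exactly `4` rows. [cite: CremonaAlgorithms1997, Tables] -/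
theorem rank3Table_countP_sigma_floor4 : rank3Table.countP (fun r => decide (r.N ^ 4 ≤ r.delta.natAbs)) = 4 := by
  decide +kernel

/-- **KERNEL**: the four rows with `σ ≥ 4`, by label. [cite: CremonaAlgorithms1997, Tables] -/
theorem rank3Table_sigma_floor4_labels :
    (rank3Table.filter fun r => decide (r.N ^ 4 ≤ r.delta.natAbs)).map Rank3Row.label =
      ["237917a1", "333111b1", "380582i3", "447458i2"] := by
  decide +kernel

/-- **KERNEL**: the rows with `σ ≥ 43/10` (`N⁴³ ≤ |Δ|¹⁰`) are `237917a1`, `333111b1` (engine-side `σ = 4.3207…` = the table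
maximum, resp. `4.3204…`). [cite: CremonaAlgorithms1997, Tables] -/
theorem rank3Table_sigma_ge_43_10_labels :
    (rank3Table.filter fun r => decide (r.N ^ 43 ≤ r.delta.natAbs ^ 10)).map Rank3Row.label = ["237917a1", "333111b1"] := by
  decide +kernel

/-- **KERNEL CENSUS**: `|Δ| = N` (`σ = 1`) on exactly `443` rows. [cite: CremonaAlgorithms1997, Tables] -/
theorem rank3Table_countP_delta_eq_N : rank3Table.countP (fun r => r.delta.natAbs == r.N) = 443 := by
  decide +kernel

/-- Two-sided primality test below `708²`: trial division by the `126` primes `< 708` of KCI row 52 (`sqTestPrimes`; only the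
cover `sqTestPrimes_cover` and `2 ≤ p` are used). [folklore] -/
def prime708B (n : ℕ) : Bool :=
  decide (2 ≤ n) && sqTestPrimes.all fun p => p == n || n % p != 0

/-- **Soundness**: below `708²` a passing test is a prime (a composite `n` has `minFac n < 708`, which has a listed divisor).
[folklore] -/
theorem prime_of_prime708B {n : ℕ} (hn : n < 708 * 708) (h : prime708B n = true) : n.Prime := by
  have h' : 2 ≤ n ∧ ∀ p ∈ sqTestPrimes, p = n ∨ n % p ≠ 0 := by
    simpa [prime708B, List.all_eq_true] using h
  obtain ⟨h2, hall⟩ := h'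
  by_contra hnp
  have hpos : 0 < n := by omega
  have hmf_lt : n.minFac < n := (Nat.not_prime_iff_minFac_lt h2).mp hnp
  have hmf_sq : n.minFac ^ 2 ≤ n := Nat.minFac_sq_le_self hpos hnp
  have hmf2 : 2 ≤ n.minFac := (Nat.minFac_prime (by omega)).two_le
  have hmf708 : n.minFac < 708 := by nlinarith
  rcases sqTestPrimes_cover _ hmf708 with hlt | ⟨p, hp, hpd⟩
  · omega
  · have hpn : p ∣ n := hpd.trans (Nat.minFac_dvd n)
    have hple : p ≤ n.minFac := Nat.le_of_dvd (by omega) hpd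
    rcases hall p hp with hpeq | hmod
    · omega
    · exact hmod (Nat.mod_eq_zero_of_dvd hpn)

/-- **Completeness**: a prime passes the test (a listed `p ≥ 2` dividing the prime `n` equals `n`). [folklore] -/
theorem prime708B_of_prime {n : ℕ} (hp : n.Prime) : prime708B n = true := by
  have h' : 2 ≤ n ∧ ∀ p ∈ sqTestPrimes, p = n ∨ n % p ≠ 0 := by
    refine ⟨hp.two_le, fun p hpmem => ?_⟩
    by_cases hpn : p = n
    · exact Or.inl hpn
    · refine Or.inr fun hmod => ?_
      rcases (Nat.dvd_prime hp).mp (Nat.dvd_of_mod_eq_zero hmod) with h1 | h1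
      · have := two_le_of_mem_sqTestPrimes p hpmem; omega
      · exact hpn h1
  simpa [prime708B, List.all_eq_true] using h'

/-- **KERNEL CENSUS**: exactly `168` rank-3 census curves have prime conductor. [cite: CremonaAlgorithms1997, Tables] -/
theorem rank3Table_countP_primeN : rank3Table.countP (fun r => prime708B r.N) = 168 := by
  decide +kernel

/-- **KERNEL**: on every prime-conductor row, `|Δ| = N`. [cite: MestreOesterle1989, §5 Théorème 2] -/
theorem rank3Table_primeN_delta_eq_N : (rank3Table.all fun r => !prime708B r.N || r.delta.natAbs == r.N) = true := by
  decide +kernel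

/-- **KERNEL**: every prime-conductor row passes row 52's semistability test (a prime is squarefree). [cite: Silverman1994, IV.10.2] -/
theorem rank3Table_primeN_semistableB : (rank3Table.all fun r => !prime708B r.N || r.semistableB) = true := by
  decide +kernel

/-! ## §3 Per-row readings by name: `1 ≤ σ < 13/3`; the prime-conductor stratum `Δ_min = ±p` (Mestre–Oesterlé shape) -/

namespace Rank3Row
variable {r : Rank3Row}

/-- `N_r ∣ |Δ_r|` per row. [cite: Silverman1994, IV.11.1] -/
theorem N_dvd_natAbs_delta_of_mem (hr : r ∈ rank3Table) : r.N ∣ r.delta.natAbs :=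
  Nat.dvd_of_mod_eq_zero (by simpa using List.all_eq_true.mp rank3Table_all_N_dvd_delta r hr)

/-- `N_r ≤ |Δ_r|` per row. [cite: Silverman1994, IV.11.1] -/
theorem N_le_natAbs_delta_of_mem (hr : r ∈ rank3Table) : r.N ≤ r.delta.natAbs :=
  Nat.le_of_dvd (one_le_natAbs_delta_of_mem hr) (N_dvd_natAbs_delta_of_mem hr)

/-- By name: `N_E ∣ N(𝔇_min)` and `N_E ≤ N(𝔇_min)` for every census curve. [cite: Silverman1994, IV.11.1] -/
theorem conductorNorm_dvd_minimalDiscriminantNorm_of_mem (hr : r ∈ rank3Table) :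
    r.curve.conductorNorm ℤ ∣ r.curve.minimalDiscriminantNorm ℤ := by
  rw [Rank3Row.conductorNorm_eq_of_mem hr, minimalDiscriminantNorm_eq_of_mem hr]; exact N_dvd_natAbs_delta_of_mem hr

/-- **`1 ≤ σ(E_r) < 13/3` for every rank-3 census curve** (hypothesis-free). [cite: Petsche2006, (1)] -/
theorem szpiroRatio_mem_Ico_of_mem (hr : r ∈ rank3Table) :
    1 ≤ r.curve.szpiroRatio ℤ ∧ r.curve.szpiroRatio ℤ < 13 / 3 := by
  refine ⟨?_, ?_⟩
  · have := div_le_szpiroRatio_of_pow_le_pow hr (a := 1) (b := 1) one_pos (by simpa using N_le_natAbs_delta_of_mem hr)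
    simpa using this
  · have := szpiroRatio_lt_div_of_pow_lt_pow hr (a := 3) (b := 13) (by norm_num)
      (of_decide_eq_true (List.all_eq_true.mp rank3Table_all_delta_cube_lt r hr))
    simpa using this

/-- In particular `σ(E_r) < 5`: Szpiro's inequality `|Δ_min| ≤ C·N⁶` holds on the table with `C = 1` (a finite check, no bearing
on the conjecture). [cite: SilvermanAEC2009, Conj. VIII.11.1] -/
theorem szpiroRatio_lt_five_of_mem (hr : r ∈ rank3Table) : r.curve.szpiroRatio ℤ < 5 :=
  lt_trans (szpiroRatio_mem_Ico_of_mem hr).2 (by norm_num)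

/-- `σ = 1` exactly when `|Δ| = N`. [cite: Petsche2006, (1)] -/
theorem szpiroRatio_eq_one_of_delta_eq_N (hr : r ∈ rank3Table) (h : r.delta.natAbs = r.N) : r.curve.szpiroRatio ℤ = 1 := by
  rw [szpiroRatio_eq_of_mem hr, h, div_self (ne_of_gt (log_N_pos_of_mem hr))]

/-- Prime conductor per row ⇔ the kernel test (`N < 500000 < 708²`, KCI conductor row). [cite: CremonaAlgorithms1997, Tables] -/
theorem prime_N_iff_of_mem (hr : r ∈ rank3Table) : r.N.Prime ↔ prime708B r.N = true :=
  ⟨prime708B_of_prime, prime_of_prime708B (by have := of_decide_eq_true (List.all_eq_true.mp rank3Table_conductor_lt r hr); omega)⟩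

/-- **`|Δ_r| = N_r` for a prime-conductor row** (hypothesis-free). [cite: MestreOesterle1989, §5 Théorème 2] -/
theorem natAbs_delta_eq_N_of_prime (hr : r ∈ rank3Table) (hp : r.N.Prime) : r.delta.natAbs = r.N := by
  have h := List.all_eq_true.mp rank3Table_primeN_delta_eq_N r hr
  rw [(prime_N_iff_of_mem hr).mp hp] at h
  simpa using h

/-- **`N(𝔇_min) = N_E = p`: the minimal discriminant of a rank-3 census curve of prime conductor `p` is `±p`** — the Mestre–Oesterlé
shape, here a kernel fact row by row. [cite: MestreOesterle1989, §5 Théorème 2] -/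
theorem minimalDiscriminantNorm_eq_conductorNorm_of_prime (hr : r ∈ rank3Table) (hp : (r.curve.conductorNorm ℤ).Prime) :
    r.curve.minimalDiscriminantNorm ℤ = r.curve.conductorNorm ℤ := by
  rw [Rank3Row.conductorNorm_eq_of_mem hr] at hp ⊢
  rw [minimalDiscriminantNorm_eq_of_mem hr, natAbs_delta_eq_N_of_prime hr hp]

/-- **`v_p(Δ_min) = 1`** on the prime-conductor rows: there the tree's NAMED fact `mestreOesterle_factorization_le_five`
(`v_p(Δ_min) ≤ 5` for prime conductor; reduced in the tree to M–O Théorème 1, itself named) is DISCHARGED by the kernel, with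
room to spare. [cite: MestreOesterle1989, §4 Théorème 1 (p. 176), §5 Théorème 2 (p. 183)] [cite: Knapp1992, Thm. 12.11] -/
theorem factorization_minimalDiscriminantNorm_eq_one_of_prime (hr : r ∈ rank3Table) (hp : (r.curve.conductorNorm ℤ).Prime) :
    (r.curve.minimalDiscriminantNorm ℤ).factorization (r.curve.conductorNorm ℤ) = 1 := by
  rw [minimalDiscriminantNorm_eq_conductorNorm_of_prime hr hp, Nat.Prime.factorization_self hp]

/-- … hence the named fact's instance `v_p(Δ_min) ≤ 5` on these rows. [cite: MestreOesterle1989, §4 Théorème 1 (p. 176)] -/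
theorem factorization_minimalDiscriminantNorm_le_five_of_prime (hr : r ∈ rank3Table) (hp : (r.curve.conductorNorm ℤ).Prime) :
    (r.curve.minimalDiscriminantNorm ℤ).factorization (r.curve.conductorNorm ℤ) ≤ 5 :=
  (factorization_minimalDiscriminantNorm_eq_one_of_prime hr hp).trans_le (by norm_num)

/-- Prime-conductor rows are semistable (by name through KCI row 52). [cite: Silverman1994, IV.10.2] -/
theorem isSemistable_of_prime (hr : r ∈ rank3Table) (hp : r.N.Prime) : r.curve.IsSemistable ℤ := by
  refine isSemistable_of_mem hr ?_
  have h := List.all_eq_true.mp rank3Table_primeN_semistableB r hr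
  rw [(prime_N_iff_of_mem hr).mp hp] at h
  simpa using h

/-- Prime-conductor rows have Szpiro ratio exactly `1`. [cite: Petsche2006, (1)] -/
theorem szpiroRatio_eq_one_of_prime (hr : r ∈ rank3Table) (hp : r.N.Prime) : r.curve.szpiroRatio ℤ = 1 :=
  szpiroRatio_eq_one_of_delta_eq_N hr (natAbs_delta_eq_N_of_prime hr hp)

/-! ## §4 Lang's height inequality per row — Petsche's explicit constant, uniform over the table (the fact BY NAME) -/

/-- **Lang's height inequality for a census row** (Petsche 2006, Thm. 2 over `ℚ`, BY NAME): for every non-torsion `P ∈ E_r(ℚ)`,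
`c(1, σ_r) · log|Δ_r| ≤ ĥ(P)` with `ĥ(P) = canonicalHeight P / 2` (Silverman's normalisation) and `σ_r = log|Δ_r|/log N_r`. The hypothesis
`hPT` is PROVED in the tree (`Petsche2006_langHeightLowerBound_holds`). [cite: Petsche2006, Thm. 2, (5)] -/
theorem langHeight_of_mem (hPT : Petsche2006_langHeightLowerBound) (hr : r ∈ rank3Table) (P : r.curve.toAffine.Point)
    (hP : ¬ IsOfFinAddOrder P) :
    Petsche2006.langConstant 1 (r.curve.szpiroRatio ℤ) * Real.log (r.delta.natAbs : ℝ) ≤ P.canonicalHeight / 2 := by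
  haveI := isElliptic_of_mem hr
  have h := hPT r.curve P hP
  rw [minimalDiscriminantNorm_eq_of_mem hr] at h
  exact h

/-- **One constant for the whole table**: `c(1,5) · log N_r ≤ ĥ(P)` for every non-torsion `P ∈ E_r(ℚ)` on every rank-3 census curve
(`1 ≤ σ_r < 5`, `c(1,·)` antitone, `N_r ≤ |Δ_r|`). [cite: Petsche2006, Thm. 2, (5)] -/
theorem langHeight_uniform_of_mem (hPT : Petsche2006_langHeightLowerBound) (hr : r ∈ rank3Table) (P : r.curve.toAffine.Point)
    (hP : ¬ IsOfFinAddOrder P) : Petsche2006.langConstant 1 5 * Real.log (r.N : ℝ) ≤ P.canonicalHeight / 2 := by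
  refine le_trans ?_ (langHeight_of_mem hPT hr P hP)
  have hN1 : (1 : ℝ) ≤ (r.N : ℝ) := by exact_mod_cast (one_lt_N_of_mem hr).le
  have hN0 : (0 : ℝ) < (r.N : ℝ) := lt_of_lt_of_le zero_lt_one hN1
  have hND : (r.N : ℝ) ≤ (r.delta.natAbs : ℝ) := by exact_mod_cast N_le_natAbs_delta_of_mem hr
  exact mul_le_mul (langConstant_one_anti (szpiroRatio_mem_Ico_of_mem hr).1 (szpiroRatio_lt_five_of_mem hr).le)
    (Real.log_le_log hN0 hND) (Real.log_nonneg hN1) (Petsche2006.langConstant_nonneg zero_le_one _)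

/-- **Table-wide**: `c(1,5) · log 5077 ≤ ĥ(P)` for every non-torsion rational point on every one of the 9 487 rank-3 census curves
(engine-side `c(1,5) · log 5077 = 2.50…·10⁻²¹`; explicit, not sharp). [cite: Petsche2006, Thm. 2, (5)] -/
theorem langHeight_tablewide_of_mem (hPT : Petsche2006_langHeightLowerBound) (hr : r ∈ rank3Table) (P : r.curve.toAffine.Point)
    (hP : ¬ IsOfFinAddOrder P) : Petsche2006.langConstant 1 5 * Real.log 5077 ≤ P.canonicalHeight / 2 := by
  refine le_trans ?_ (langHeight_uniform_of_mem hPT hr P hP)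
  have h5077 : (5077 : ℝ) ≤ (r.N : ℝ) := by exact_mod_cast N_ge_of_mem hr
  exact mul_le_mul_of_nonneg_left (Real.log_le_log (by norm_num) h5077) (Petsche2006.langConstant_nonneg zero_le_one _)

/-- **Petsche's count of small points per row** (Prop. 7 over `ℚ`, BY NAME; PROVED in the tree as `Petsche2006_card_smallPoints_le_holds`):
at most `c₁ σ_r² log(c₂ σ_r²)` points of `E_r(ℚ)` have `ĥ(P) ≤ log|Δ_r| / (2¹³·3·σ_r²)`. [cite: Petsche2006, Prop. 7, (11)] -/
theorem card_smallPoints_le_of_mem (hP7 : Petsche2006_card_smallPoints_le) (hr : r ∈ rank3Table) :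
    {P : r.curve.toAffine.Point | P.canonicalHeight / 2 ≤
        Petsche2006.smallHeightBound 1 (r.curve.szpiroRatio ℤ) (Real.log (r.delta.natAbs : ℝ))}.Finite ∧
      (({P : r.curve.toAffine.Point | P.canonicalHeight / 2 ≤
          Petsche2006.smallHeightBound 1 (r.curve.szpiroRatio ℤ) (Real.log (r.delta.natAbs : ℝ))}.ncard : ℝ) ≤
        Petsche2006.countBound 1 (r.curve.szpiroRatio ℤ)) := by
  haveI := isElliptic_of_mem hr
  have h := hP7 r.curve
  rw [minimalDiscriminantNorm_eq_of_mem hr] at h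
  exact h

end Rank3Row

/-! ## §5 Summary -/

/-- **THE SZPIRO RATIO CENSUS OF THE RANK-3 TABLE** (hypothesis-free): `σ ∈ [1, 13/3)` on every row, floor histogram
`7174 / 2179 / 130 / 4`, `σ = 1` on `443` rows, `168` prime-conductor rows all with `|Δ| = N`. [cite: CremonaAlgorithms1997, Tables] -/
theorem rank3_szpiroRatioCensus :
    (∀ r ∈ rank3Table, 1 ≤ r.curve.szpiroRatio ℤ ∧ r.curve.szpiroRatio ℤ < 13 / 3) ∧
      rank3Table.countP (fun r => decide (r.delta.natAbs < r.N ^ 2)) = 7174 ∧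
      rank3Table.countP (fun r => decide (r.N ^ 2 ≤ r.delta.natAbs ∧ r.delta.natAbs < r.N ^ 3)) = 2179 ∧
      rank3Table.countP (fun r => decide (r.N ^ 3 ≤ r.delta.natAbs ∧ r.delta.natAbs < r.N ^ 4)) = 130 ∧
      rank3Table.countP (fun r => decide (r.N ^ 4 ≤ r.delta.natAbs)) = 4 ∧
      rank3Table.countP (fun r => r.delta.natAbs == r.N) = 443 ∧
      rank3Table.countP (fun r => prime708B r.N) = 168 ∧
      (∀ r ∈ rank3Table, r.N.Prime → r.curve.minimalDiscriminantNorm ℤ = r.N) :=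
  ⟨fun _ hr => Rank3Row.szpiroRatio_mem_Ico_of_mem hr, rank3Table_countP_sigma_floor1, rank3Table_countP_sigma_floor2,
    rank3Table_countP_sigma_floor3, rank3Table_countP_sigma_floor4, rank3Table_countP_delta_eq_N, rank3Table_countP_primeN,
    fun _ hr hp => by rw [Rank3Row.minimalDiscriminantNorm_eq_of_mem hr, Rank3Row.natAbs_delta_eq_N_of_prime hr hp]⟩

end Summit.BirchSwinnertonDyer.BirchSwinnertonDyer.Rank2Observatory
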